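import Literature.AlgebraicGeometry.Frobenioids.ArchimedeanNonIsotropicAnchors
import Literature.AlgebraicGeometry.Frobenioids.ArchimedeanQuotientLiftingAngular
import HarnessLib

/-!
# Frobenioids II, Proposition 3.5 (iii): a complex object of the angloid `N` over an RC-anchor of `D` is
# an anchor of `N[ℂ]` (the anchor core of "(iii) follows by the same scheme")

Mochizuki, *The geometry of Frobenioids II: poly-Frobenioids*, Kyushu J. Math. **62** (2008) 401–460,
§3, Proposition 3.5 (iii), kurims text p. 34, proof p. 35 ll. 28–40 [cite: MochizukiFrdII2008, Prop 3.5 (iii) p.34]: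
"The categories `N`, `R` are of RC-iso-subanchor type … the same scheme … shows that `C` is an anchor of
`G[ℂ]`: an irreducible morphism `φ : C → C′` of `G` is either a pull-back morphism or an isometric
pre-step [since all morphisms of `G` are linear isometries], and the finiteness … follows from the fact
that `C_D` is an anchor of `D[ℂ]` (respectively, from Lemma 3.2, (iii), (vii))."

PROOF-ONLY helper (abc-iut cell, layer L1, node `FrdII:Prop3.5(iii)`, sub-row P35-L06
`AngloidRCIsoSubanchor` — anchor core, written by seat abc-iut-w4-d092 for the (iii) holder abc-iut-w4-d027
to consume BY NAME), for the NON-RIGIDIFIED angloid `N = A^lin` over ANY `π : D → D₀`: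
**`NonIso.N.isAnchor_complexPart`** — an object `X` of `N` over `Spec ℂ` whose `D`-component is an anchor
of `D[ℂ]` is an anchor of the complex part `N[ℂ]` (for `N → C → D → D₀ → ArchBase`), whatever its angular
region (isotropic allowed: `N` has no Frobenius-type arrows). Method: an `N[ℂ]`-irreducible arrow is
irreducible in `C` (a factorisation in `C` of a linear isometry between complex objects IS a
factorisation in `N[ℂ]`: `N.irreducible_toC`), so the `C`-level sorting of `ArchimedeanNonIsotropic*.lean`
applies verbatim — pull-back kind ↦ push-forward classes of irreducibles of `D[ℂ]`
(`NonIso.full_of_irreducible`, `irreducible_snd`, `under_iso_push`), pre-step kind ↦ the isotropic hull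
(`NonIso.fac_ext`, `extHom_irreducible_imp`) — and isomorphisms under `X` in `C` between such arrows lift
to `N[ℂ]` (`N.underIso_of_C`). No definitions; no statement of the paper is strengthened; nothing here
bears on [IUTchIII] Cor. 3.12.
-/

namespace Literature.AlgebraicGeometry.Frobenioids

open CategoryTheory Set
open scoped Pointwise

noncomputable section

universe v u

namespace ArchFrd

variable {D : Type u} [Category.{v} D] (π : D ⥤ D0)

namespace NonIso

namespace N

/-- In a full subcategory, an arrow whose underlying arrow is an isomorphism is an isomorphism. [folklore] -/
private theorem isIso_of_isIso_hom₃ {T : Type u} [Category.{v} T] {P : ObjectProperty T}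
    {A B : P.FullSubcategory} (f : A ⟶ B) [IsIso f.hom] : IsIso f :=
  ⟨⟨ObjectProperty.homMk (inv f.hom), ObjectProperty.hom_ext _ (IsIso.hom_inv_id f.hom),
    ObjectProperty.hom_ext _ (IsIso.inv_hom_id f.hom)⟩⟩

/-! ### Wrapping arrows of `C` into `N` and `N[ℂ]` -/

/-- "Complex for the RC-structure of Prop. 3.5 (iii)" means `π(X_D) = Spec ℂ`. [cite: MochizukiFrdII2008, Def 3.1 (v) p.24] -/
theorem isComplex_iff (X : ArchFrd.N π) :
    RC.complexObjects (N.toC π ⋙ PreFrobenioid.baseFunctor (C.toElem π) ⋙ baseRC π) X ↔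
      (π.obj X.obj.obj.snd).IsComplex :=
  D0.isComplex_toArchBase_iff _

/-- An arrow of `C` into a complex object of `N` has complex source. [cite: MochizukiFrdII2008, §3 p.23] -/
theorem isComplex_of_hom {W Y : C π} (α : W ⟶ Y) (hY : (π.obj Y.snd).IsComplex) : (π.obj W.snd).IsComplex := by
  have h : π.obj W.snd ⟶ D0.complex := hY ▸ π.map α.snd
  exact D0.eq_complex_of_hom_complex h

/-- Two arrows of `N` with the same underlying arrow of `C` coincide. [cite: MochizukiFrdII2008, Ex 3.3 (iii) p.29] -/
theorem hom_ext₂ {X Y : ArchFrd.N π} {g h : X ⟶ Y} (e : g.hom.hom = h.hom.hom) : g = h :=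
  WideSubcategory.hom_ext _ (WideSubcategory.hom_ext _ e)

/-- An arrow of `N` whose underlying arrow of `C` is invertible is invertible. [cite: MochizukiFrdII2008, Ex 3.3 (iii) p.29] -/
theorem isIso_of_isIso_hom_hom {X Y : ArchFrd.N π} (g : X ⟶ Y) [IsIso g.hom.hom] : IsIso g :=
  ArchFrd.N.isIso_of_isIso_hom g

/-! ### Irreducibility in `N[ℂ]` is irreducibility in `C` -/

/-- **An `N[ℂ]`-irreducible arrow is irreducible in `C`**: every factorisation in `C` of a linear isometry
into a complex object is a factorisation by linear isometries through a complex object (`Φ₀` is sharp;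
degrees multiply; arrows into `Spec ℂ` come from `Spec ℂ`). [cite: MochizukiFrdII2008, Prop 3.5 (iii) p.34] -/
theorem irreducible_toC
    {Xc Yc : (RC.complexObjects (N.toC π ⋙ PreFrobenioid.baseFunctor (C.toElem π) ⋙ baseRC π)).FullSubcategory}
    (f : Xc ⟶ Yc) (hf : IsIrreducibleHom f) : IsIrreducibleHom f.hom.hom.hom := by
  have hY : (π.obj Yc.obj.obj.obj.snd).IsComplex := (isComplex_iff π Yc.obj).mp Yc.property
  refine ⟨fun hi => hf.1 ?_, fun W β α hβα => ?_⟩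
  · haveI := hi
    haveI : IsIso f.hom := isIso_of_isIso_hom_hom π f.hom
    exact isIso_of_isIso_hom₃ f
  · have hW : (π.obj W.snd).IsComplex := isComplex_of_hom π α hY
    have hWc : RC.complexObjects (N.toC π ⋙ PreFrobenioid.baseFunctor (C.toElem π) ⋙ baseRC π)
        (⟨⟨W⟩⟩ : ArchFrd.N π) := (isComplex_iff π _).mpr hW
    have hisoβα : PreFrobenioid.IsIsometry (C.toElem π) (β ≫ α) := by rw [hβα]; exact f.hom.hom.property
    obtain ⟨hβ, hα⟩ := C.isIsometry_of_fac π β α hisoβα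
    have hlin : C0.degFr (β ≫ α).fst = 1 := by rw [hβα]; exact f.hom.property
    obtain ⟨hdβ, hdα⟩ := C0.degFr_eq_one_of_comp β.fst α.fst hlin
    let W' : (RC.complexObjects (N.toC π ⋙ PreFrobenioid.baseFunctor (C.toElem π) ⋙ baseRC π)).FullSubcategory :=
      ⟨⟨⟨W⟩⟩, hWc⟩
    let β' : Xc ⟶ W' := ObjectProperty.homMk (⟨⟨β, hβ⟩, hdβ⟩ : Xc.obj ⟶ (⟨⟨W⟩⟩ : ArchFrd.N π))
    let α' : W' ⟶ Yc := ObjectProperty.homMk (⟨⟨α, hα⟩, hdα⟩ : (⟨⟨W⟩⟩ : ArchFrd.N π) ⟶ Yc.obj)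
    have hfac : β' ≫ α' = f := ObjectProperty.hom_ext _ (hom_ext₂ π hβα)
    rcases hf.2 β' α' hfac with hi | hi
    · haveI := hi
      exact Or.inl (inferInstance : IsIso (((RC.complexObjects
        (N.toC π ⋙ PreFrobenioid.baseFunctor (C.toElem π) ⋙ baseRC π)).ι ⋙ N.toC π).map α'))
    · haveI := hi
      exact Or.inr (inferInstance : IsIso (((RC.complexObjects
        (N.toC π ⋙ PreFrobenioid.baseFunctor (C.toElem π) ⋙ baseRC π)).ι ⋙ N.toC π).map β'))

/-! ### Isomorphisms under `X` in `C` lift to `N[ℂ]` -/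

/-- **Isomorphisms under `X` in `C` between arrows of `N[ℂ]` are isomorphisms under `X` in `N[ℂ]`** (the
comparison isomorphism is a linear isometry: `Φ₀` sharp, degrees multiply).
[cite: MochizukiFrdII2008, Prop 3.5 (iii) p.34] -/
theorem underIso_of_C
    {Xc Yc Yc' : (RC.complexObjects (N.toC π ⋙ PreFrobenioid.baseFunctor (C.toElem π) ⋙ baseRC π)).FullSubcategory}
    (f : Xc ⟶ Yc) (f' : Xc ⟶ Yc') (e : Under.mk f.hom.hom.hom ≅ Under.mk f'.hom.hom.hom) :
    Nonempty (Under.mk f ≅ Under.mk f') := by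
  have hw : f.hom.hom.hom ≫ e.hom.right = f'.hom.hom.hom := Under.w e.hom
  haveI : IsIso e.hom.right := (inferInstance : IsIso ((Under.forget _).map e.hom))
  have hj : PreFrobenioid.IsIsometry (C.toElem π) e.hom.right :=
    (C.isIsometry_of_fac π f.hom.hom.hom e.hom.right (by rw [hw]; exact f'.hom.hom.property)).2
  have hdj : C0.degFr (e.hom.right).fst = 1 := by
    have h : C0.degFr (f.hom.hom.hom ≫ e.hom.right).fst = 1 := by rw [hw]; exact f'.hom.property
    exact (C0.degFr_eq_one_of_comp _ _ h).2
  let j : Yc.obj ⟶ Yc'.obj := ⟨⟨e.hom.right, hj⟩, hdj⟩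
  haveI : IsIso j.hom.hom := by change IsIso e.hom.right; infer_instance
  haveI : IsIso j := isIso_of_isIso_hom_hom π j
  let j' : Yc ⟶ Yc' := ObjectProperty.homMk j
  haveI : IsIso j'.hom := by change IsIso j; infer_instance
  have hj' : IsIso j' := isIso_of_isIso_hom₃ j'
  exact ⟨Under.isoMk (@asIso _ _ _ _ j' hj') (ObjectProperty.hom_ext _ (hom_ext₂ π hw))⟩

/-! ### The push-forward and the hull as arrows of `N[ℂ]` -/

/-- The push-forward `(𝟙, h) : X → X_h` is a linear isometry, i.e. an arrow of `N`, into a complex object.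
[cite: MochizukiFrdII2008, Prop 3.5 (iii) p.34] -/
theorem isIsometry_pushHom (X : C π) {Z : D} (h : X.snd ⟶ Z) (hZ : (π.obj Z).IsComplex) :
    PreFrobenioid.IsIsometry (C.toElem π) (pushHom π X h hZ) := by
  change PreFrobenioid.IsIsometry C0.toElem (𝟙 X.fst)
  rw [A0.isIsometry_iff_norm_mul_tip_pow, C0.scalar_id', C0.degFr_id', Units.val_one, norm_one, one_mul,
    PNat.one_coe, pow_one]

/-- The push-forward class map `^{X_D} D[ℂ] → ^X N[ℂ]`. [cite: MochizukiFrdII2008, Prop 3.5 (iii) p.34] -/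
theorem exists_pushClassMap
    (Xc : (RC.complexObjects (N.toC π ⋙ PreFrobenioid.baseFunctor (C.toElem π) ⋙ baseRC π)).FullSubcategory) :
    ∃ G : Quotient (isIsomorphicSetoid (Under (⟨Xc.obj.obj.obj.snd, Xc.property⟩ : RC.ComplexPart (baseRC π)))) →
        Quotient (isIsomorphicSetoid (Under Xc)),
      ∀ (g : Under (⟨Xc.obj.obj.obj.snd, Xc.property⟩ : RC.ComplexPart (baseRC π)))
        (hZ : (π.obj g.right.obj).IsComplex)
        (hZ' : RC.complexObjects (N.toC π ⋙ PreFrobenioid.baseFunctor (C.toElem π) ⋙ baseRC π)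
          (⟨⟨pushObj π Xc.obj.obj.obj g.hom.hom hZ⟩⟩ : ArchFrd.N π)),
        G (Quotient.mk _ g) = Quotient.mk _ (Under.mk (ObjectProperty.homMk
          (⟨⟨pushHom π Xc.obj.obj.obj g.hom.hom hZ, isIsometry_pushHom π _ g.hom.hom hZ⟩, rfl⟩ :
            Xc.obj ⟶ (⟨⟨pushObj π Xc.obj.obj.obj g.hom.hom hZ⟩⟩ : ArchFrd.N π)) :
            Xc ⟶ ⟨⟨⟨pushObj π Xc.obj.obj.obj g.hom.hom hZ⟩⟩, hZ'⟩)) := by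
  let X : C π := Xc.obj.obj.obj
  have hZ : ∀ g : Under (⟨X.snd, Xc.property⟩ : RC.ComplexPart (baseRC π)), (π.obj g.right.obj).IsComplex :=
    fun g => (D0.complexObjects_comp_iff π g.right.obj).mp g.right.property
  have hZ' : ∀ g : Under (⟨X.snd, Xc.property⟩ : RC.ComplexPart (baseRC π)),
      RC.complexObjects (N.toC π ⋙ PreFrobenioid.baseFunctor (C.toElem π) ⋙ baseRC π)
        (⟨⟨pushObj π X g.hom.hom (hZ g)⟩⟩ : ArchFrd.N π) := fun g => (isComplex_iff π _).mpr (hZ g)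
  let u : Under (⟨X.snd, Xc.property⟩ : RC.ComplexPart (baseRC π)) → Under Xc := fun g =>
    Under.mk (ObjectProperty.homMk
      (⟨⟨pushHom π X g.hom.hom (hZ g), isIsometry_pushHom π _ _ _⟩, rfl⟩ :
        Xc.obj ⟶ (⟨⟨pushObj π X g.hom.hom (hZ g)⟩⟩ : ArchFrd.N π)) :
      Xc ⟶ ⟨⟨⟨pushObj π X g.hom.hom (hZ g)⟩⟩, hZ' g⟩)
  refine ⟨Quotient.map' u ?_, fun g _ _ => rfl⟩
  rintro g g' ⟨i⟩
  exact underIso_of_C π (u g).hom (u g').hom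
    (Classical.choice (push_under_iso π X g.hom.hom g'.hom.hom (hZ g) (hZ g')
      ((RC.complexObjects (baseRC π)).ι.mapIso ((Under.forget _).mapIso i))
      (congrArg (fun k => k.hom) (Under.w i.hom))))

/-- The region enlargement `X → X_T` with the same tip is a linear isometry.
[cite: MochizukiFrdII2008, Prop 3.5 (iii) p.34] -/
theorem isIsometry_extHom (X : C π) (T : AngularRegion ℂ) (hT : X.fst.region.dir ⊆ T.dir)
    (ht : X.fst.region.tip = T.tip) :
    PreFrobenioid.IsIsometry (C.toElem π) (extHom π X T hT ht.le) := by
  change PreFrobenioid.IsIsometry C0.toElem (extHom π X T hT ht.le).fst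
  rw [A0.isIsometry_iff_norm_mul_tip_pow]
  change ‖((1 : ℂˣ) : ℂ)‖ * X.fst.tip ^ ((1 : ℕ+) : ℕ) = (T.tip : ℝ)
  rw [Units.val_one, norm_one, one_mul, PNat.one_coe, pow_one, C0.tip_eq, ht]

/-! ### The anchor theorem for `N[ℂ]` -/

/-- **A complex object of `N` lying over an anchor of `D[ℂ]` is an anchor of `N[ℂ]`** (the anchor core of
the proof of Prop. 3.5 (iii), p. 35: "`C` is an anchor of `G[ℂ]`"), for the angloid `N ⊆ C₀ ×_{D₀} D` over
any `π : D → D₀` and any angular region of `X`. [cite: MochizukiFrdII2008, Prop 3.5 (iii) p.34] -/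
theorem isAnchor_complexPart
    (Xc : (RC.complexObjects (N.toC π ⋙ PreFrobenioid.baseFunctor (C.toElem π) ⋙ baseRC π)).FullSubcategory)
    (hA : IsAnchor (⟨Xc.obj.obj.obj.snd, Xc.property⟩ : RC.ComplexPart (baseRC π))) : IsAnchor Xc := by
  let X : C π := Xc.obj.obj.obj
  have hXc : (π.obj X.snd).IsComplex := (isComplex_iff π Xc.obj).mp Xc.property
  obtain ⟨G, hG⟩ := exists_pushClassMap π Xc
  -- the hull arrow as an arrow of `N[ℂ]`
  let Hobj : (RC.complexObjects (N.toC π ⋙ PreFrobenioid.baseFunctor (C.toElem π) ⋙ baseRC π)).FullSubcategory :=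
    ⟨⟨⟨extObj π X (AngularRegion.isotropicOfTip X.fst.region.tip) (subset_univ _)⟩⟩, (isComplex_iff π _).mpr hXc⟩
  let hull : Xc ⟶ Hobj := ObjectProperty.homMk
    (⟨⟨extHom π X (AngularRegion.isotropicOfTip X.fst.region.tip) (subset_univ _) le_rfl,
      isIsometry_extHom π X (AngularRegion.isotropicOfTip X.fst.region.tip) (subset_univ _) rfl⟩, rfl⟩ :
      Xc.obj ⟶ (⟨⟨extObj π X (AngularRegion.isotropicOfTip X.fst.region.tip) (subset_univ _)⟩⟩ : ArchFrd.N π))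
  let SH : Set (Quotient (isIsomorphicSetoid (Under Xc))) := {Quotient.mk _ (Under.mk hull)}
  let SP : Set (Quotient (isIsomorphicSetoid (Under Xc))) :=
    G '' {y | ∃ g : Under (⟨X.snd, Xc.property⟩ : RC.ComplexPart (baseRC π)),
      IsIrreducibleHom g.hom ∧ Quotient.mk _ g = y}
  refine ((finite_singleton _).union (hA.image G) : (SH ∪ SP).Finite).subset ?_
  rintro x ⟨f, hf, rfl⟩
  have hirr : IsIrreducibleHom f.hom.hom.hom.hom := irreducible_toC π f.hom hf
  have hd : C0.degFr f.hom.hom.hom.hom.fst = 1 := f.hom.hom.property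
  have hY : (π.obj f.right.obj.obj.obj.snd).IsComplex := (isComplex_iff π f.right.obj).mp f.right.property
  by_cases hs : IsIso f.hom.hom.hom.hom.snd
  · -- pre-step kind: the isotropic hull
    refine Or.inl ?_
    obtain ⟨T₀, hT, ht, j, hfac, hj⟩ := fac_ext π f.hom.hom.hom.hom hd
    haveI := hj hs
    have hirr' : IsIrreducibleHom (extHom π X T₀ hT ht) := by
      have e : extHom π X T₀ hT ht = f.hom.hom.hom.hom ≫ inv j := by
        rw [← cancel_mono j, Category.assoc, IsIso.inv_hom_id, Category.comp_id]; exact hfac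
      rw [e]; exact IsIrreducibleHom.comp_isIso hirr _
    have hT₀ := extHom_irreducible_imp π X T₀ hT ht hirr'
    subst hT₀
    exact mem_singleton_iff.mpr (Quotient.sound (underIso_of_C π f.hom hull
      (Under.isoMk (@asIso _ _ _ _ j (hj hs)) hfac).symm))
  · -- pull-back kind: the push-forward of an irreducible of `D[ℂ]`
    refine Or.inr ?_
    obtain ⟨-, hfull⟩ := full_of_irreducible π f.hom.hom.hom.hom hirr hs
    have hcY : RC.complexObjects (baseRC π) f.right.obj.obj.obj.snd := (D0.complexObjects_comp_iff π _).mpr hY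
    let g : Under (⟨X.snd, Xc.property⟩ : RC.ComplexPart (baseRC π)) :=
      Under.mk (ObjectProperty.homMk f.hom.hom.hom.hom.snd :
        (⟨X.snd, Xc.property⟩ : RC.ComplexPart (baseRC π)) ⟶ ⟨f.right.obj.obj.obj.snd, hcY⟩)
    refine ⟨Quotient.mk _ g, ⟨g, irreducible_snd π f.hom.hom.hom.hom hirr hd hfull Xc.property hcY, rfl⟩, ?_⟩
    rw [hG g hY ((isComplex_iff π _).mpr hY)]
    exact Quotient.sound (underIso_of_C π _ f.hom
      (Classical.choice (under_iso_push π f.hom.hom.hom.hom hd hfull hY)))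

end N

end NonIso

end ArchFrd

end

end Literature.AlgebraicGeometry.Frobenioids
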